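import Summits.BirchSwinnertonDyer.Rank1Residual.X11b.Three.GoodReductionSubgroupCuspPresentation
import Summits.BirchSwinnertonDyer.Rank1Residual.X11b.Three.JetchevKummerLinkGlobal
import HarnessLib

/-!
# X11b at `p = 3` (team N8/O2), S15 (iv)/(v): Jetchev's Prop. 4.1 at an ADDITIVE place in the
# restricted-global KUMMER currency — `δ_v(t) ∈ H¹_{Kum⁰}(K_v, E[p^m])` with `hstab` and (α)
# DISCHARGED (the additive companion of `MultiplicativePlaceAlpha`)

HONEST FRAMING (cell `b2b-bsdres`, run/shared/lean/b2b/bsd-rank1-residual/, verbatim in every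
file): the goal of the cell is to DELETE the COMBINATION-SHAPED residual classes of the
Birch–Swinnerton-Dyer formula for ALL analytic-rank `≤ 1` elliptic curves over `ℚ` — "full BSD
formula for every rank `≤ 1` curve in class `C`" assembled STRICTLY from published theorems — so
that the rank-`≤ 1` remainder becomes exactly the CONSTRUCTION-SHAPED classes, which are TYPED
(missing-input `Prop`s), NOT attempted. This is not "finishing BSD". Team N8/O2 = `x11b3`, seat
`b2b-bsdres-x11b3-p2` (GEN 3), LEAD DEAL #7 R7-28 (3) ("p1's END-FORM assembly consumes
`hα_of_hasAdditiveReduction_of_adicComplete` at additive `v` in the (C2) currency, via p2's leaf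
pattern"). LABEL OF RECORD: flag-discharge hygiene for `JET@p|N` (harvest E66 (D)) — NOT
count-moving; nothing is booked; `O2` OPEN. THEOREMS ONLY: no definition, no named fact, no
`sorry`. The flag `JET@p|N` is NOT discharged here.

## What

x11b3-p1's `localKummerMap_mem_connectedKummerCondition_of_cocycle_baseChange`
(`JetchevKummerLinkGlobal`, p253808) — Jetchev 2008 Prop. 4.1 at a bad place `v` of a GLOBAL curve
`W/K₀` in the restricted-global currency, `δ_v(t) ∈ H¹_{Kum⁰}(K_v, E[p^m])`, modulo `hstab`, (α),
(b) and the cocycle — at a place where `(W⁄F)⁄L` has ADDITIVE reduction over the complete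
unramified layer ring `R`: `hstab` = x11b3-p4's `smul_mem_goodReductionSubgroup` (p252933) and (α) =
x11b3-p4's `hα_of_hasAdditiveReduction_of_adicComplete` (`GoodReductionSubgroupCuspPresentation`,
S15 (v): the cusp `Ẽ_ns ≅ 𝔾_a`, ADDITIVE Hilbert 90, and the formal-group half
`h1ker_of_adicComplete`).

* **`localKummerMap_mem_connectedKummerCondition_of_cocycle_of_hasAdditiveReduction`** — Prop. 4.1
  at an ADDITIVE place `v` of a global curve, Kummer currency, modulo input (b) and the cocycle
  rooted at `t ∈ (W⁄F)(F)` ONLY. Residual layer binders = x11b3-p4's `S15-INTERFACE.md` §4 R1–R6,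
  R8 and **R7′ = `[((W⁄F)⁄L).HasAdditiveReduction R]` on the LAYER** — which contains the
  minimality of the `K_v`-minimal equation over the unramified `L_w` at an ADDITIVE place (Tate's
  algorithm under unramified base change; NOT in the tree; LABELLED residual input of record,
  LEAD R7-28 (2)).

Content at `p = 3`: an additive place `v ∤ 3` of Kodaira type IV or IV* may have `c_v = 3`, and
then the connected condition `H¹_{Kum⁰}` can be strictly smaller than the Kummer condition (the
(T2γ)@3 atom of the census); at places with `3 ∤ c_v` the two coincide (`JetchevKummerLink`
`connectedKummerCondition_eq_of_coprime`).

References (locators only; no new fact): [cite: Jetchev2008, Prop. 4.1 (pp. 819–821), Lemma 3.2]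
[cite: GrossLMS1991, Prop. 6.2 (1), pp. 244–245] [cite: MilneADT2006, Ch. I Prop. 3.8]
[cite: SilvermanAEC2009, VII.2 Prop. 2.1, Prop. III.2.5(b)]; cell files p252933, p253058, p253808,
p255785, x11b3-p4's parts 12–14 (`GoodReductionSubgroupCusp*`), p257338 (`MultiplicativePlaceAlpha`).

## Design

No definitions; `noncomputable section`; `open scoped Classical`; universe `u` for `K₀`, `F`, `L`
as in `JetchevKummerLinkGlobal`. Axioms: `propext`, `Classical.choice`, `Quot.sound`.
-/

noncomputable section

open scoped Classical

namespace Summit.BirchSwinnertonDyer.Rank1Residual.X11b.Three.JetchevKummer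

open WeierstrassCurve Literature.NumberTheory.EllipticCurves

universe u

variable {K₀ : Type u} [Field K₀] [CharZero K₀] (W : WeierstrassCurve K₀) [W.IsElliptic]
  (F : Type u) [Field F] [Algebra K₀ F] [CharZero F]
  (L : Type u) [Field L] [Algebra F L]
  (R₀ : Type*) [CommRing R₀] [IsDomain R₀] [IsDiscreteValuationRing R₀] [Algebra R₀ F]
  [IsFractionRing R₀ F]
  (R : Type*) [CommRing R] [IsDomain R] [IsDiscreteValuationRing R] [Algebra R L]
  [IsFractionRing R L]
  [Algebra R₀ R] [Algebra R₀ L] [IsScalarTower R₀ R L] [IsScalarTower R₀ F L]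
  [IsAdicComplete (IsLocalRing.maximalIdeal R) R] [Finite (IsLocalRing.ResidueField R)]
  (W₀ : WeierstrassCurve R)

/-- **Jetchev 2008, Prop. 4.1 at an ADDITIVE place `v` of a GLOBAL curve, restricted-global Kummer
currency, modulo inputs (a), (b) and the cocycle ONLY.** `W` over a global field `K₀` (`ℚ`, or
the Heegner field), `F = K_v` with valuation ring `R₀`, a Galois layer `L ⊇ F` (the completion
`K[c]_w`) with complete valuation ring `R`, `R₀ → R` local, finite residue field of order `qⁿ`,
`Aut(L/F) = ⟨φ⟩`, `φⁿ = 1`, `φ` lifting `x ↦ x^q`, every `τ` preserving `R`, a uniformiser of `R`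
from `F`, and `(W⁄F)⁄L` with ADDITIVE reduction over `R` (R7′: includes minimality over the
layer); `W⁄F` minimal over `R₀`. Given (b) `hP`/`hR'` and the explicit cocycle `hU`/`hpU` rooted at
`t ∈ (W⁄F)(F)` (input (a)): **`W.localKummerMap F hn t ∈ connectedKummerCondition W F R₀ hn`** —
x11b3-p1's `localKummerMap_mem_connectedKummerCondition_of_cocycle_baseChange` with `hstab` and (α)
DISCHARGED (x11b3-p4's `smul_mem_goodReductionSubgroup`, `hα_of_hasAdditiveReduction_of_adicComplete`).
`JET@p|N` NOT discharged. [cite: Jetchev2008, Prop. 4.1 (pp. 819–821)]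
[cite: GrossLMS1991, Prop. 6.2 (1), pp. 244–245] [cite: MilneADT2006, Ch. I Prop. 3.8] -/
theorem localKummerMap_mem_connectedKummerCondition_of_cocycle_of_hasAdditiveReduction
    [((W.baseChange F).baseChange L).HasAdditiveReduction R]
    (hX : (W.baseChange F).baseChange L = W₀.baseChange L)
    [IsGalois F L] [IsLocalHom (algebraMap R₀ R)] [(W.baseChange F).IsMinimal R₀]
    (hR : ∀ (τ : L ≃ₐ[F] L) (x : L), x ∈ Set.range (algebraMap R L) →
      τ x ∈ Set.range (algebraMap R L))
    (φ : L ≃ₐ[F] L) (hφ : ∀ σ : L ≃ₐ[F] L, σ ∈ Subgroup.zpowers φ) {q n : ℕ} (hφn : φ ^ n = 1)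
    (hcard : Nat.card (IsLocalRing.ResidueField R) = q ^ n)
    (hfrob : ∀ a : R, ∃ a' : R, algebraMap R L a' = φ (algebraMap R L a) ∧
      IsLocalRing.residue R a' = IsLocalRing.residue R a ^ q)
    {ϖ : R} (hϖ : Irreducible ϖ) {π : F} (hπ : algebraMap F L π = algebraMap R L ϖ)
    {p m n' : ℕ} (hcop : Nat.Coprime n' (p ^ m)) (hn : ((p ^ m : ℕ) : ℤ) ≠ 0)
    {t : (W.baseChange F).toAffine.Point} {U P : ((W.baseChange F).baseChange L).toAffine.Point}
    {Rσ : (L ≃ₐ[F] L) → ((W.baseChange F).baseChange L).toAffine.Point}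
    (hP : (n' : ℤ) • P ∈ ((W.baseChange F).baseChange L).goodReductionSubgroup R)
    (hR' : ∀ σ : L ≃ₐ[F] L, (n' : ℤ) • Rσ σ ∈ ((W.baseChange F).baseChange L).goodReductionSubgroup R)
    (hU : ∀ σ : L ≃ₐ[F] L, σ • U - U = Rσ σ)
    (hpU : ((p ^ m : ℕ) : ℤ) • U =
      P - Affine.Point.baseChange (W' := (W.baseChange F).toAffine) F L t) :
    W.localKummerMap F hn t ∈ connectedKummerCondition W F R₀ hn :=
  localKummerMap_mem_connectedKummerCondition_of_cocycle_baseChange W F L R₀ R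
    (fun σ _ hQ ↦ smul_mem_goodReductionSubgroup (W.baseChange F) L R hR σ hQ)
    (hα_of_hasAdditiveReduction_of_adicComplete (W.baseChange F) L R W₀ hX hR φ hφ hφn hcard
      hfrob hϖ hπ)
    hcop hn hP hR' hU hpU

end Summit.BirchSwinnertonDyer.Rank1Residual.X11b.Three.JetchevKummer

end
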